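import Literature.NumberTheory.Automorphic.GLnAdelicStructureProofs
import Literature.LinearAlgebra.Matrix.GLIdempotentDecomposition
import HarnessLib

/-!
# Truncation of `GL_n(𝔸_K)` away from a finite set of places: the factors `G_T`, `H^T` and the level `K^T`

Topic `NumberTheory/Automorphic`; definitions (`finiteAdeleAwayIdem`, `adeleAwayIdem`, `awayLevel`)
and theorems. For a number field `K` and a finite set `T` of finite places let
`e^T = (0_∞, 1^T) ∈ 𝔸_K` be the idempotent adele which is `1` at the finite places outside `T` and `0`
at `T` and at infinity (`adeleAwayIdem K T`, `isIdempotentElem_adeleAwayIdem`). By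
`Literature.LinearAlgebra.Matrix.truncGLContinuousEquiv` (`GLIdempotentDecomposition`),
`GL_n(𝔸_K)` is the internal direct product, as a topological group, of the ranges of the two
truncations `π_{e^T}`, `π_{1 - e^T}`; this file identifies them:

* `mem_range_truncGL_adeleAwayIdem_iff`: `range π_{e^T} = H^T = GL_n(𝔸_K^T)`, the adelic matrices
  with archimedean component `1` and components `1` at the places of `T`;
* `mem_range_truncGL_one_sub_adeleAwayIdem_iff`: `range π_{1-e^T} = G_T = GL_n(𝔸_{K,T})`, the
  adelic matrices with components `1` at the finite places outside `T`;
* `awayLevel K n T = K^T = H^T ∩ K^max` (`K^max = glIntegralLevel`: finite part in `GL_n(𝒪̂_K)`,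
  archimedean part `1`), i.e. `∏_{w ∉ T} GL_n(𝒪_w)` placed in `H^T`: compact
  (`isCompact_awayLevel`, the image of `K^max` under `π_{e^T}`), relatively open in `H^T`
  (`awayLevel_eq_range_inf_comap` with `isOpen_comap_sndHom_glFiniteIntegralLevel`), and maximal
  at every `w ∉ T` (`isMaximalAt_awayLevel`: `ι_w(GL_n(𝒪_w)) ≤ K^T`, with `ι_w = GLn.ofLocal`
  landing in `H^T`, `ofLocal_mem_range_truncGL`).

Purpose: the decomposition `GL_n(𝔸_K) ≅ G_T × H^T` with the compact open subgroup `K^T ≤ H^T` is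
the group-theoretic input of the "`K^T`-spherical unfolding" of the global Godement–Jacquet zeta
integral (Haar measure `= Haar(G_T) ⊗ Haar(H^T)`, then integration over `H^T` modulo `K^T` by
`CosetIntegral` and Tamagawa's identity place by place, `TamagawaHeckeSeries`), the route by which
`Literature.NumberTheory.Automorphic.GodementJacquet1972_gjZeta_eulerFactorisation` is to be
proved (decomposition of `godementJacquet_hasMeromorphicContinuation`, lang.S21). Weil,
*Basic Number Theory* (1967), Ch. IV §1 (adeles away from a finite set of places);
Godement–Jacquet, LNM 260 (1972), §10.

## Design notes

* No restricted-product splitting `𝔸_K^∞ ≅ ∏_{w ∈ T} K_w × 𝔸_K^{∞, T}` is used: everything is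
  phrased inside `GL_n(𝔸_K)` through the idempotent `e^T` (an element of Mathlib's restricted
  product, `RestrictedProduct.mk` of the `0/1` family) and the tree's projections
  `(gl n K).toLocal w`, `GLn.fstHom`, `GLn.sndHom` and embeddings `GLn.ofLocal`.
* `AdeleRing (𝓞 K) K` is a type synonym of `K_∞ × 𝔸_K^∞`; componentwise computations go through
  `Prod.ext` / `.1` / `adeleEval` rather than `Prod.mk` lemmas.
-/

noncomputable section



open NumberField IsDedekindDomain

namespace Literature.NumberTheory.Automorphic

variable (K : Type) [Field K] [NumberField K]

open scoped Classical in
/-- The finite adele `1^T` which is `0` at the places of the finite set `T` and `1` at every other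
finite place (an element of the restricted product: `0, 1 ∈ 𝒪_w`). [folklore] -/
def finiteAdeleAwayIdem (T : Finset (HeightOneSpectrum (𝓞 K))) : FiniteAdeleRing (𝓞 K) K :=
  RestrictedProduct.mk (fun w => if w ∈ T then (0 : w.adicCompletion K) else 1)
    (Filter.Eventually.of_forall fun w => by
      by_cases hw : w ∈ T
      · simp only [hw, if_true]; exact zero_mem _
      · simp only [hw, if_false]; exact one_mem _)

open scoped Classical in
/-- Components of `1^T`. [folklore] -/
theorem finiteAdeleAwayIdem_apply (T : Finset (HeightOneSpectrum (𝓞 K))) (w : HeightOneSpectrum (𝓞 K)) :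
    finiteAdeleAwayIdem K T w = if w ∈ T then (0 : w.adicCompletion K) else 1 := rfl

/-- The adele `e^T = (0_∞, 1^T)`: `1` at the finite places outside `T`, `0` at `T` and at the
archimedean places. [folklore] -/
def adeleAwayIdem (T : Finset (HeightOneSpectrum (𝓞 K))) : AdeleRing (𝓞 K) K :=
  (0, finiteAdeleAwayIdem K T)

/-- `e^T` is an idempotent. [folklore] -/
theorem isIdempotentElem_adeleAwayIdem (T : Finset (HeightOneSpectrum (𝓞 K))) :
    IsIdempotentElem (adeleAwayIdem K T) := by
  rw [IsIdempotentElem, adeleAwayIdem]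
  apply Prod.ext
  · change (0 : InfiniteAdeleRing K) * 0 = 0
    exact mul_zero _
  change finiteAdeleAwayIdem K T * finiteAdeleAwayIdem K T = finiteAdeleAwayIdem K T
  apply FiniteAdeleRing.ext
  intro w
  rw [show (finiteAdeleAwayIdem K T * finiteAdeleAwayIdem K T) w =
      finiteAdeleAwayIdem K T w * finiteAdeleAwayIdem K T w from rfl, finiteAdeleAwayIdem_apply]
  split_ifs <;> simp

/-- The archimedean component of `e^T` vanishes. [folklore] -/
@[simp]
theorem adeleAwayIdem_fst (T : Finset (HeightOneSpectrum (𝓞 K))) : (adeleAwayIdem K T).1 = 0 := rfl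

open scoped Classical in
/-- The finite components of `e^T`. [folklore] -/
theorem adeleEval_adeleAwayIdem (T : Finset (HeightOneSpectrum (𝓞 K))) (w : HeightOneSpectrum (𝓞 K)) :
    AdelicGroupData.adeleEval K w (adeleAwayIdem K T) = if w ∈ T then 0 else 1 := rfl

/-! ### The factor subgroups of `GL_n(𝔸_K)` cut out by `e^T` -/

open Literature.LinearAlgebra.Matrix

variable {K}

/-- An idempotent endomorphism has range equal to its fixed points. [folklore] -/
theorem mem_range_truncGL_iff_eq {R : Type*} [CommRing R] {m : Type*} [Fintype m] [DecidableEq m]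
    {e : R} (he : IsIdempotentElem e) (g : GL m R) :
    g ∈ (truncGL m he).range ↔ truncGL m he g = g := by
  constructor
  · rintro ⟨h, rfl⟩
    exact truncGL_truncGL he h
  · intro h
    exact ⟨g, h⟩

variable (n : ℕ)

/-- **The factor `H^T = GL_n(𝔸_K^T)`.** For the idempotent adele `e^T` (`1` off `T` at the finite
places, `0` at `T` and at infinity), an adelic `g ∈ GL_n(𝔸_K)` lies in the range of the truncation
`π_{e^T}` iff its archimedean component is `1` and its components at the places of `T` are `1`.
[folklore] -/
theorem mem_range_truncGL_adeleAwayIdem_iff (T : Finset (HeightOneSpectrum (𝓞 K)))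
    (g : GL (Fin n) (AdeleRing (𝓞 K) K)) :
    g ∈ (truncGL (Fin n) (isIdempotentElem_adeleAwayIdem K T)).range ↔
      GLn.fstHom n K g = 1 ∧ ∀ w ∈ T, (AdelicGroupData.gl n K).toLocal w g = 1 := by
  classical
  rw [mem_range_truncGL_iff_eq]
  constructor
  · intro h
    have hm : ∀ i j, adeleAwayIdem K T * (g : Matrix (Fin n) (Fin n) (AdeleRing (𝓞 K) K)) i j +
        (1 - adeleAwayIdem K T) * (1 : Matrix (Fin n) (Fin n) (AdeleRing (𝓞 K) K)) i j =
        (g : Matrix (Fin n) (Fin n) (AdeleRing (𝓞 K) K)) i j := by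
      intro i j
      have := congrArg (fun u : GL (Fin n) (AdeleRing (𝓞 K) K) =>
        (u : Matrix (Fin n) (Fin n) (AdeleRing (𝓞 K) K)) i j) h
      simpa [coe_truncGL, Matrix.add_apply, Matrix.smul_apply, smul_eq_mul] using this
    refine ⟨Matrix.GeneralLinearGroup.ext fun i j => ?_, fun w hw => Matrix.GeneralLinearGroup.ext
      fun i j => ?_⟩
    · -- archimedean components: `(e^T)_∞ = 0`
      have h1 := congrArg Prod.fst (hm i j)
      change (adeleAwayIdem K T).1 * ((g : Matrix (Fin n) (Fin n) (AdeleRing (𝓞 K) K)) i j).1 +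
        (1 - adeleAwayIdem K T).1 * ((1 : Matrix (Fin n) (Fin n) (AdeleRing (𝓞 K) K)) i j).1 =
        ((g : Matrix (Fin n) (Fin n) (AdeleRing (𝓞 K) K)) i j).1 at h1
      rw [show (1 - adeleAwayIdem K T).1 = 1 - (adeleAwayIdem K T).1 from rfl, adeleAwayIdem_fst,
        zero_mul, zero_add, sub_zero, one_mul] at h1
      change ((g : Matrix (Fin n) (Fin n) (AdeleRing (𝓞 K) K)) i j).1 =
        ((1 : GL (Fin n) (InfiniteAdeleRing K)) : Matrix (Fin n) (Fin n) (InfiniteAdeleRing K)) i j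
      rw [Units.val_one, ← h1, Matrix.one_apply, Matrix.one_apply]
      split_ifs <;> rfl
    · -- components at `w ∈ T`: `(e^T)_w = 0`
      have h1 := congrArg (AdelicGroupData.adeleEval K w) (hm i j)
      rw [map_add, map_mul, map_mul, map_sub, map_one, adeleEval_adeleAwayIdem, if_pos hw, zero_mul,
        zero_add, sub_zero, one_mul] at h1
      change AdelicGroupData.adeleEval K w ((g : Matrix (Fin n) (Fin n) (AdeleRing (𝓞 K) K)) i j) =
        ((1 : GL (Fin n) (w.adicCompletion K)) : Matrix (Fin n) (Fin n) (w.adicCompletion K)) i j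
      rw [Units.val_one, ← h1, adeleEval_one_apply]
  · rintro ⟨harch, hT⟩
    refine Matrix.GeneralLinearGroup.ext fun i j => ?_
    rw [coe_truncGL, Matrix.add_apply, Matrix.smul_apply, Matrix.smul_apply, smul_eq_mul, smul_eq_mul]
    -- check the identity componentwise in `𝔸_K = K_∞ × 𝔸_K^∞`
    apply Prod.ext
    · have h1 : ((g : Matrix (Fin n) (Fin n) (AdeleRing (𝓞 K) K)) i j).1 =
          ((1 : Matrix (Fin n) (Fin n) (AdeleRing (𝓞 K) K)) i j).1 := by
        have h2 := congrArg (fun u : GL (Fin n) (InfiniteAdeleRing K) =>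
          (u : Matrix (Fin n) (Fin n) (InfiniteAdeleRing K)) i j) harch
        change ((g : Matrix (Fin n) (Fin n) (AdeleRing (𝓞 K) K)) i j).1 =
          ((1 : GL (Fin n) (InfiniteAdeleRing K)) : Matrix (Fin n) (Fin n) (InfiniteAdeleRing K)) i j
          at h2
        rw [h2, Units.val_one, Matrix.one_apply, Matrix.one_apply]
        split_ifs <;> rfl
      change (adeleAwayIdem K T).1 * ((g : Matrix (Fin n) (Fin n) (AdeleRing (𝓞 K) K)) i j).1 +
        (1 - adeleAwayIdem K T).1 * ((1 : Matrix (Fin n) (Fin n) (AdeleRing (𝓞 K) K)) i j).1 =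
        ((g : Matrix (Fin n) (Fin n) (AdeleRing (𝓞 K) K)) i j).1
      rw [show (1 - adeleAwayIdem K T).1 = 1 - (adeleAwayIdem K T).1 from rfl, adeleAwayIdem_fst,
        zero_mul, zero_add, sub_zero, one_mul, h1]
    · apply FiniteAdeleRing.ext
      intro w
      change AdelicGroupData.adeleEval K w (adeleAwayIdem K T *
          (g : Matrix (Fin n) (Fin n) (AdeleRing (𝓞 K) K)) i j +
          (1 - adeleAwayIdem K T) * (1 : Matrix (Fin n) (Fin n) (AdeleRing (𝓞 K) K)) i j) =
        AdelicGroupData.adeleEval K w ((g : Matrix (Fin n) (Fin n) (AdeleRing (𝓞 K) K)) i j)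
      rw [map_add, map_mul, map_mul, map_sub, map_one, adeleEval_adeleAwayIdem]
      by_cases hw : w ∈ T
      · rw [if_pos hw, zero_mul, zero_add, sub_zero, one_mul, adeleEval_one_apply]
        have h2 := congrArg (fun u : GL (Fin n) (w.adicCompletion K) =>
          (u : Matrix (Fin n) (Fin n) (w.adicCompletion K)) i j) (hT w hw)
        change AdelicGroupData.adeleEval K w ((g : Matrix (Fin n) (Fin n) (AdeleRing (𝓞 K) K)) i j) =
          ((1 : GL (Fin n) (w.adicCompletion K)) : Matrix (Fin n) (Fin n) (w.adicCompletion K)) i j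
          at h2
        rw [Units.val_one] at h2
        exact h2.symm
      · rw [if_neg hw, one_mul, sub_self, zero_mul, add_zero]

/-- **The factor `G_T = GL_n(𝔸_{K,T})`.** An adelic `g` lies in the range of the truncation
`π_{1 - e^T}` iff its components at the finite places outside `T` are `1` (no condition at `T`
or at infinity). [folklore] -/
theorem mem_range_truncGL_one_sub_adeleAwayIdem_iff (T : Finset (HeightOneSpectrum (𝓞 K)))
    (g : GL (Fin n) (AdeleRing (𝓞 K) K)) :
    g ∈ (truncGL (Fin n) (isIdempotentElem_adeleAwayIdem K T).one_sub).range ↔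
      ∀ w ∉ T, (AdelicGroupData.gl n K).toLocal w g = 1 := by
  classical
  rw [mem_range_truncGL_iff_eq]
  constructor
  · intro h w hw
    have hm : ∀ i j, (1 - adeleAwayIdem K T) * (g : Matrix (Fin n) (Fin n) (AdeleRing (𝓞 K) K)) i j +
        (1 - (1 - adeleAwayIdem K T)) * (1 : Matrix (Fin n) (Fin n) (AdeleRing (𝓞 K) K)) i j =
        (g : Matrix (Fin n) (Fin n) (AdeleRing (𝓞 K) K)) i j := by
      intro i j
      have := congrArg (fun u : GL (Fin n) (AdeleRing (𝓞 K) K) =>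
        (u : Matrix (Fin n) (Fin n) (AdeleRing (𝓞 K) K)) i j) h
      simpa [coe_truncGL, Matrix.add_apply, Matrix.smul_apply, smul_eq_mul] using this
    refine Matrix.GeneralLinearGroup.ext fun i j => ?_
    have h1 := congrArg (AdelicGroupData.adeleEval K w) (hm i j)
    rw [sub_sub_cancel, map_add, map_mul, map_mul, map_sub, map_one, adeleEval_adeleAwayIdem, if_neg hw,
      sub_self, zero_mul, zero_add, one_mul] at h1
    change AdelicGroupData.adeleEval K w ((g : Matrix (Fin n) (Fin n) (AdeleRing (𝓞 K) K)) i j) =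
      ((1 : GL (Fin n) (w.adicCompletion K)) : Matrix (Fin n) (Fin n) (w.adicCompletion K)) i j
    rw [Units.val_one, ← h1, adeleEval_one_apply]
  · intro hT
    refine Matrix.GeneralLinearGroup.ext fun i j => ?_
    rw [coe_truncGL, Matrix.add_apply, Matrix.smul_apply, Matrix.smul_apply, smul_eq_mul, smul_eq_mul,
      sub_sub_cancel]
    apply Prod.ext
    · change (1 - adeleAwayIdem K T).1 * ((g : Matrix (Fin n) (Fin n) (AdeleRing (𝓞 K) K)) i j).1 +
        (adeleAwayIdem K T).1 * ((1 : Matrix (Fin n) (Fin n) (AdeleRing (𝓞 K) K)) i j).1 =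
        ((g : Matrix (Fin n) (Fin n) (AdeleRing (𝓞 K) K)) i j).1
      rw [show (1 - adeleAwayIdem K T).1 = 1 - (adeleAwayIdem K T).1 from rfl, adeleAwayIdem_fst,
        zero_mul, add_zero, sub_zero, one_mul]
    · apply FiniteAdeleRing.ext
      intro w
      change AdelicGroupData.adeleEval K w ((1 - adeleAwayIdem K T) *
          (g : Matrix (Fin n) (Fin n) (AdeleRing (𝓞 K) K)) i j +
          adeleAwayIdem K T * (1 : Matrix (Fin n) (Fin n) (AdeleRing (𝓞 K) K)) i j) =
        AdelicGroupData.adeleEval K w ((g : Matrix (Fin n) (Fin n) (AdeleRing (𝓞 K) K)) i j)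
      rw [map_add, map_mul, map_mul, map_sub, map_one, adeleEval_adeleAwayIdem]
      by_cases hw : w ∈ T
      · rw [if_pos hw, sub_zero, one_mul, zero_mul, add_zero]
      · rw [if_neg hw, sub_self, zero_mul, zero_add, one_mul, adeleEval_one_apply]
        have h2 := congrArg (fun u : GL (Fin n) (w.adicCompletion K) =>
          (u : Matrix (Fin n) (Fin n) (w.adicCompletion K)) i j) (hT w hw)
        change AdelicGroupData.adeleEval K w ((g : Matrix (Fin n) (Fin n) (AdeleRing (𝓞 K) K)) i j) =
          ((1 : GL (Fin n) (w.adicCompletion K)) : Matrix (Fin n) (Fin n) (w.adicCompletion K)) i j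
          at h2
        rw [Units.val_one] at h2
        exact h2.symm

/-! ### The level `K^T` of the factor `H^T` -/

variable (K) in
/-- **The spherical level away from `T`**: `K^T = {1_∞} × ∏_{w ∈ T} {1} × ∏_{w ∉ T} GL_n(𝒪_w)`, the
adelic matrices in the factor `H^T` (`1` at `T` and at infinity) whose finite part lies in
`GL_n(𝒪̂_K)`; i.e. `H^T ∩ K^max` with `K^max = glIntegralLevel` (Godement–Jacquet, LNM 260, §10;
Borel–Jacquet (1979), §4.6). [folklore] -/
def awayLevel (T : Finset (HeightOneSpectrum (𝓞 K))) : Subgroup (GL (Fin n) (AdeleRing (𝓞 K) K)) :=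
  (truncGL (Fin n) (isIdempotentElem_adeleAwayIdem K T)).range ⊓ glIntegralLevel n K

/-- Membership in `K^T`. [folklore] -/
theorem mem_awayLevel_iff (T : Finset (HeightOneSpectrum (𝓞 K))) (g : GL (Fin n) (AdeleRing (𝓞 K) K)) :
    g ∈ awayLevel K n T ↔
      g ∈ (truncGL (Fin n) (isIdempotentElem_adeleAwayIdem K T)).range ∧ g ∈ glIntegralLevel n K :=
  Iff.rfl

/-- `K^T ≤ H^T`. [folklore] -/
theorem awayLevel_le_range (T : Finset (HeightOneSpectrum (𝓞 K))) :
    awayLevel K n T ≤ (truncGL (Fin n) (isIdempotentElem_adeleAwayIdem K T)).range :=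
  inf_le_left

/-- `K^T ≤ K^max`. [folklore] -/
theorem awayLevel_le_glIntegralLevel (T : Finset (HeightOneSpectrum (𝓞 K))) :
    awayLevel K n T ≤ glIntegralLevel n K :=
  inf_le_right

/-- Truncation at `e^T` preserves integrality of the finite part and triviality of the
archimedean part: `π_{e^T}(K^max) ⊆ K^max`. [folklore] -/
theorem truncGL_mem_glIntegralLevel (T : Finset (HeightOneSpectrum (𝓞 K)))
    {g : GL (Fin n) (AdeleRing (𝓞 K) K)} (hg : g ∈ glIntegralLevel n K) :
    truncGL (Fin n) (isIdempotentElem_adeleAwayIdem K T) g ∈ glIntegralLevel n K := by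
  classical
  rw [mem_glIntegralLevel_iff'] at hg ⊢
  obtain ⟨⟨hint, hinv⟩, harch⟩ := hg
  have hT : ∀ w, ((adeleAwayIdem K T).2 : FiniteAdeleRing (𝓞 K) K) w ∈ w.adicCompletionIntegers K := by
    intro w
    change finiteAdeleAwayIdem K T w ∈ _
    rw [finiteAdeleAwayIdem_apply]
    split_ifs
    · exact zero_mem _
    · exact one_mem _
  have he2 : (adeleAwayIdem K T).2 ∈ integralFiniteAdeles K := (mem_integralFiniteAdeles_iff).2 hT
  have hsub : (1 - adeleAwayIdem K T).2 ∈ integralFiniteAdeles K :=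
    Subring.sub_mem _ (Subring.one_mem _) he2
  have hone : ∀ i j : Fin n, ((1 : Matrix (Fin n) (Fin n) (AdeleRing (𝓞 K) K)) i j).2 ∈
      integralFiniteAdeles K := by
    intro i j
    rw [Matrix.one_apply]
    split_ifs
    · exact Subring.one_mem _
    · exact Subring.zero_mem _
  refine ⟨⟨fun i j => ?_, fun i j => ?_⟩, fun i j => ?_⟩
  · rw [coe_truncGL, Matrix.add_apply, Matrix.smul_apply, Matrix.smul_apply, smul_eq_mul, smul_eq_mul]
    exact Subring.add_mem _ (Subring.mul_mem _ he2 (hint i j)) (Subring.mul_mem _ hsub (hone i j))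
  · rw [← map_inv, coe_truncGL, Matrix.add_apply, Matrix.smul_apply, Matrix.smul_apply, smul_eq_mul,
      smul_eq_mul]
    exact Subring.add_mem _ (Subring.mul_mem _ he2 (hinv i j)) (Subring.mul_mem _ hsub (hone i j))
  · rw [coe_truncGL, Matrix.add_apply, Matrix.smul_apply, Matrix.smul_apply, smul_eq_mul, smul_eq_mul]
    change (adeleAwayIdem K T).1 * ((g : Matrix (Fin n) (Fin n) (AdeleRing (𝓞 K) K)) i j).1 +
      (1 - adeleAwayIdem K T).1 * ((1 : Matrix (Fin n) (Fin n) (AdeleRing (𝓞 K) K)) i j).1 = _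
    rw [show (1 - adeleAwayIdem K T).1 = 1 - (adeleAwayIdem K T).1 from rfl, adeleAwayIdem_fst,
      zero_mul, zero_add, sub_zero, one_mul, Matrix.one_apply, Matrix.one_apply]
    split_ifs <;> rfl

/-- `K^T = π_{e^T}(K^max)`. [folklore] -/
theorem awayLevel_eq_image (T : Finset (HeightOneSpectrum (𝓞 K))) :
    (awayLevel K n T : Set (GL (Fin n) (AdeleRing (𝓞 K) K))) =
      truncGL (Fin n) (isIdempotentElem_adeleAwayIdem K T) '' (glIntegralLevel n K) := by
  ext g
  simp only [SetLike.mem_coe, mem_awayLevel_iff, Set.mem_image]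
  constructor
  · rintro ⟨hg, hint⟩
    refine ⟨g, hint, ?_⟩
    exact (mem_range_truncGL_iff_eq _ g).1 hg
  · rintro ⟨k, hk, rfl⟩
    exact ⟨⟨k, rfl⟩, truncGL_mem_glIntegralLevel n T hk⟩

/-- **`K^T` is compact** (the continuous image of the compact `K^max`,
`isCompact_glIntegralLevel_holds`). [folklore] -/
theorem isCompact_awayLevel (T : Finset (HeightOneSpectrum (𝓞 K))) :
    IsCompact (awayLevel K n T : Set (GL (Fin n) (AdeleRing (𝓞 K) K))) := by
  rw [awayLevel_eq_image]
  exact (isCompact_glIntegralLevel_holds n K).image (continuous_truncGL _)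

/-- **`K^T` is relatively open in `H^T`**: it is the trace on `H^T` of the open set
`{g : g_f ∈ GL_n(𝒪̂_K)}` (`isOpen_glFiniteIntegralLevel` pulled back along the continuous finite
projection). [folklore] -/
theorem awayLevel_eq_range_inf_comap (T : Finset (HeightOneSpectrum (𝓞 K))) :
    awayLevel K n T = (truncGL (Fin n) (isIdempotentElem_adeleAwayIdem K T)).range ⊓
      (glFiniteIntegralLevel n K).comap (GLn.sndHom n K) := by
  ext g
  rw [mem_awayLevel_iff, Subgroup.mem_inf, Subgroup.mem_comap, mem_glIntegralLevel_iff]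
  constructor
  · rintro ⟨hH, hf, -⟩
    exact ⟨hH, hf⟩
  · rintro ⟨hH, hf⟩
    exact ⟨hH, hf, ((mem_range_truncGL_adeleAwayIdem_iff n T g).1 hH).1⟩

/-- The open set `{g ∈ GL_n(𝔸_K) : g_f ∈ GL_n(𝒪̂_K)}` is open. [folklore] -/
theorem isOpen_comap_sndHom_glFiniteIntegralLevel :
    IsOpen ((glFiniteIntegralLevel n K).comap (GLn.sndHom n K) :
      Set (GL (Fin n) (AdeleRing (𝓞 K) K))) :=
  (isOpen_glFiniteIntegralLevel n K).preimage (continuous_snd.generalLinearGroup_map)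

/-! ### The local embeddings land in the factor `H^T` and its level -/

/-- For `w ∉ T`, the local embedding `ι_w : GL_n(K_w) → GL_n(𝔸_K)` lands in the factor `H^T`
(its components at `T` and at infinity are `1`). [folklore] -/
theorem ofLocal_mem_range_truncGL (T : Finset (HeightOneSpectrum (𝓞 K))) {w : HeightOneSpectrum (𝓞 K)}
    (hw : w ∉ T) (g : GL (Fin n) (w.adicCompletion K)) :
    GLn.ofLocal n K w g ∈ (truncGL (Fin n) (isIdempotentElem_adeleAwayIdem K T)).range := by
  rw [mem_range_truncGL_adeleAwayIdem_iff]
  refine ⟨Matrix.GeneralLinearGroup.ext fun i j => ?_, fun w' hw' => ?_⟩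
  · change ((GLn.ofLocal n K w g : Matrix (Fin n) (Fin n) (AdeleRing (𝓞 K) K)) i j).1 =
      ((1 : GL (Fin n) (InfiniteAdeleRing K)) : Matrix (Fin n) (Fin n) (InfiniteAdeleRing K)) i j
    rw [GLn.fst_coe_ofLocal_apply, Units.val_one]
  · refine GLn.toLocal_ofLocal_of_ne (fun h => ?_) g
    rw [h] at hw'
    exact hw hw'

/-- For `w ∉ T`, `ι_w(GL_n(𝒪_w)) ≤ K^T`: the level `K^T` is maximal at every place outside `T`
(`isMaximalAt_glIntegralLevel`). [folklore] -/
theorem isMaximalAt_awayLevel (T : Finset (HeightOneSpectrum (𝓞 K))) {w : HeightOneSpectrum (𝓞 K)}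
    (hw : w ∉ T) : IsMaximalAt n K w (awayLevel K n T) := by
  rintro _ ⟨g, hg, rfl⟩
  exact ⟨ofLocal_mem_range_truncGL n T hw g, isMaximalAt_glIntegralLevel n K w ⟨g, hg, rfl⟩⟩

end Literature.NumberTheory.Automorphic
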